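import Mathlib
import Summits.ResolutionOfSingularities.ResolutionOfSingularities.Theorems.WildQuotientsWildQuotientResolutionLinearSqZero

/-!
# JNF-3: normal form of a LINEAR `σ` on `k[x₁,…,xₙ]`, `n ≤ 4`, with `(σ − 1)³ = 0`

(crux stmt-ResolutionOfSingularities-15640 `WildQuotients.WildQuotientResolution`, line `Sketch`,
sector `|G| = p`; registered stub `exists_conj_normalForm_of_cube_zero` = candidate JNF-3 of
`L/w45c/W45cPlanSignaturesV4.lean` §D VERBATIM; [OURS · L1 W4.5c] replaces the role of no printed
item; NOT a statement of any manuscript. Prover res-L1-w45c-stub-4.)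

* `linearIndependent_of_cube_zero` — for a linear `N` with `N³ = 0` and a vector `v` with
  `N² v ≠ 0`, the triple `(N² v, N v, v)` is linearly independent.
* `exists_basis_of_cube_zero` — Jordan normal form of a nilpotent `N` with `N³ = 0 ≠ N²` on a
  space of dimension `≤ 4` (hence `= 3` or `= 4`): a basis `B` indexed by `Fin m`,
  `m = finrank`, and distinct indices `a b c` with `N (B c) = B b`, `N (B b) = B a`, `N (B i) = 0`
  otherwise (Jordan types `3` and `3 + 1`; the passenger of type `3 + 1` is `w = u − r₁ N v − r₂ v`
  for any `u` outside `span (N² v, N v, v)`, where `N u = r₁ N² v + r₂ N v` is forced by `N³ u = 0`).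
* `exists_conj_normalForm_of_cube_zero` — **JNF-3**: a LINEAR `σ` on `k[x₁,…,xₙ]`, `n ≤ 4`, with
  `(σ − 1)³ = 0` on the coordinates is conjugate in `Aut_k k[x]` to a linear-small-blocks datum
  (case `(σ − 1)² = 0`: `LinearSqZero.exists_conj_linearSmallBlocks_of_sq_zero`, p478142) or to a
  `J₃`-with-passengers datum (case `(σ − 1)² ≠ 0`: `exists_basis_of_cube_zero` + the coordinate
  change `LinearSqZero.exists_algEquiv_apply_X_eq`, p478142).
-/

-- single-problem summit: the doubled namespace component `ResolutionOfSingularities` is forced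
set_option linter.dupNamespace false

noncomputable section

open Module MvPolynomial

namespace Summit.ResolutionOfSingularities.ResolutionOfSingularities.Theorems.WildQuotientResolution.LinearCubeZero

section LinearAlgebra

variable {k V : Type*} [Field k] [AddCommGroup V] [Module k V]

/-- If `N³ = 0` and `N² v ≠ 0` then `N² v, N v, v` are linearly independent (apply `N` twice to a
vanishing combination). [folklore] -/
theorem linearIndependent_of_cube_zero (N : V →ₗ[k] V) (hN3 : ∀ x, N (N (N x)) = 0) (v : V)
    (hv : N (N v) ≠ 0) : LinearIndependent k ![N (N v), N v, v] := by
  rw [Fintype.linearIndependent_iff]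
  intro g hg
  simp only [Fin.sum_univ_three, Matrix.cons_val_zero, Matrix.cons_val_one,
    Matrix.cons_val_two, Matrix.head_cons, Matrix.tail_cons] at hg
  -- hg : g 0 • N (N v) + g 1 • N v + g 2 • v = 0
  have h1 : g 1 • N (N v) + g 2 • N v = 0 := by
    have h := congrArg N hg
    simpa only [map_add, map_smul, hN3, smul_zero, zero_add, map_zero] using h
  have h2 : g 2 • N (N v) = 0 := by
    have h := congrArg N h1
    simpa only [map_add, map_smul, hN3, smul_zero, zero_add, map_zero] using h
  have hg2 : g 2 = 0 := (smul_eq_zero.1 h2).resolve_right hv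
  have hg1 : g 1 = 0 := by
    rw [hg2, zero_smul, add_zero] at h1
    exact (smul_eq_zero.1 h1).resolve_right hv
  have hg0 : g 0 = 0 := by
    rw [hg1, hg2, zero_smul, zero_smul, add_zero, add_zero] at hg
    exact (smul_eq_zero.1 hg).resolve_right hv
  intro i
  fin_cases i <;> assumption

/-- **Jordan normal form for `N³ = 0 ≠ N²` in dimension `≤ 4`.** If `N³ = 0`, `N² v ≠ 0` and
`finrank V = m ≤ 4`, then `m ∈ {3, 4}` and `V` has a basis `B : Fin m → V` with distinct indices
`a b c` such that `N (B c) = B b`, `N (B b) = B a` and `N (B i) = 0` for every other `i` (for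
`m = 3`: `B = (N² v, N v, v)`; for `m = 4`: `B = (w, N² v, N v, v)` with a passenger `w ∈ ker N`).
[folklore; Jordan types `3` and `3 + 1`] -/
theorem exists_basis_of_cube_zero [FiniteDimensional k V] (N : V →ₗ[k] V)
    (hN3 : ∀ x, N (N (N x)) = 0) (v : V) (hv : N (N v) ≠ 0) {m : ℕ}
    (hm : Module.finrank k V = m) (hm4 : m ≤ 4) :
    ∃ (B : Basis (Fin m) k V) (a b c : Fin m), a ≠ b ∧ b ≠ c ∧ a ≠ c ∧
      N (B c) = B b ∧ N (B b) = B a ∧ ∀ i, i ≠ b → i ≠ c → N (B i) = 0 := by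
  have hT := linearIndependent_of_cube_zero N hN3 v hv
  have h3 : 3 ≤ m := by
    have h := hT.fintype_card_le_finrank
    rw [Fintype.card_fin, hm] at h
    exact h
  obtain rfl | rfl : m = 3 ∨ m = 4 := by omega
  · -- Jordan type `3`: the triple itself is a basis
    let B : Basis (Fin 3) k V := basisOfLinearIndependentOfCardEqFinrank hT (by rw [hm]; simp)
    have hB : ⇑B = ![N (N v), N v, v] := coe_basisOfLinearIndependentOfCardEqFinrank _ _
    refine ⟨B, 0, 1, 2, by decide, by decide, by decide, ?_, ?_, ?_⟩
    · rw [hB]; rfl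
    · rw [hB]; rfl
    · intro i hi1 hi2
      fin_cases i
      · rw [hB]; exact hN3 v
      · exact absurd rfl hi1
      · exact absurd rfl hi2
  · -- Jordan type `3 + 1`: add a passenger `w ∈ ker N`
    let W := Submodule.span k (Set.range ![N (N v), N v, v])
    have hW : W ≠ ⊤ := by
      intro h
      have h3 : Module.finrank k W = 3 := by
        have h' := finrank_span_eq_card hT
        rwa [Fintype.card_fin] at h'
      rw [h, finrank_top, hm] at h3
      omega
    obtain ⟨u, hu⟩ : ∃ u, u ∉ W := by
      by_contra! h'
      exact hW (Submodule.eq_top_iff'.2 h')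
    have hF : LinearIndependent k ![u, N (N v), N v, v] := linearIndependent_finCons.2 ⟨hT, hu⟩
    let B : Basis (Fin 4) k V := basisOfLinearIndependentOfCardEqFinrank hF (by rw [hm]; simp)
    have hB : ⇑B = ![u, N (N v), N v, v] := coe_basisOfLinearIndependentOfCardEqFinrank _ _
    -- the coordinates `r` of `N u`
    obtain ⟨r, hNu⟩ : ∃ r : Fin 4 → k,
        N u = r 0 • u + r 1 • N (N v) + r 2 • N v + r 3 • v := by
      refine ⟨fun i => B.repr (N u) i, ?_⟩
      have h := (B.sum_repr (N u)).symm
      rw [Fin.sum_univ_four, hB] at h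
      simpa using h
    have h2 : N (N u) = r 0 • N u + r 2 • N (N v) + r 3 • N v := by
      conv_lhs => rw [hNu]
      simp only [map_add, map_smul, hN3, smul_zero, add_zero]
    have h3' : N (N (N u)) = r 0 • N (N u) + r 3 • N (N v) := by
      conv_lhs => rw [h2]
      simp only [map_add, map_smul, hN3, smul_zero, add_zero]
    -- `N³ u = 0` read in the basis `B`
    have key : (r 0 ^ 3) • u + (r 0 ^ 2 * r 1 + r 0 * r 2 + r 3) • N (N v) +
        (r 0 ^ 2 * r 2 + r 0 * r 3) • N v + (r 0 ^ 2 * r 3) • v = 0 := by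
      have h0 := hN3 u
      rw [h3', h2, hNu] at h0
      linear_combination (norm := module) h0
    have hcoef := Fintype.linearIndependent_iff.1 hF
      ![r 0 ^ 3, r 0 ^ 2 * r 1 + r 0 * r 2 + r 3, r 0 ^ 2 * r 2 + r 0 * r 3, r 0 ^ 2 * r 3]
      (by
        rw [Fin.sum_univ_four]
        simpa using key)
    have hr0 : r 0 = 0 := by
      have h := hcoef 0
      simp only [Matrix.cons_val_zero] at h
      exact pow_eq_zero_iff (n := 3) (by norm_num) |>.1 h
    have hr3 : r 3 = 0 := by
      have h := hcoef 1
      simp only [Matrix.cons_val_one, hr0] at h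
      simpa using h
    -- the passenger
    set w := u - r 1 • N v - r 2 • v with hw
    have hNw : N w = 0 := by
      rw [hw, map_sub, map_sub, map_smul, map_smul, hNu, hr0, hr3]
      module
    have hwW : w ∉ W := by
      intro hw'
      apply hu
      have hu' : u = w + r 1 • N v + r 2 • v := by rw [hw]; abel
      rw [hu']
      refine Submodule.add_mem _ (Submodule.add_mem _ hw' (Submodule.smul_mem _ _
        (Submodule.subset_span ⟨1, rfl⟩))) (Submodule.smul_mem _ _ (Submodule.subset_span ⟨2, rfl⟩))
    have hF' : LinearIndependent k ![w, N (N v), N v, v] :=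
      linearIndependent_finCons.2 ⟨hT, hwW⟩
    let B' : Basis (Fin 4) k V := basisOfLinearIndependentOfCardEqFinrank hF' (by rw [hm]; simp)
    have hB' : ⇑B' = ![w, N (N v), N v, v] := coe_basisOfLinearIndependentOfCardEqFinrank _ _
    refine ⟨B', 1, 2, 3, by decide, by decide, by decide, ?_, ?_, ?_⟩
    · rw [hB']; rfl
    · rw [hB']; rfl
    · intro i hi1 hi2
      fin_cases i
      · rw [hB']; exact hNw
      · rw [hB']; exact hN3 v
      · exact absurd rfl hi1
      · exact absurd rfl hi2

end LinearAlgebra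

/-- **JNF-3** (`W45cPlanSignaturesV4.lean` §D, verbatim; registered stub
`exists_conj_normalForm_of_cube_zero`): a LINEAR `σ` on `k[x₁,…,xₙ]`, `n ≤ 4`, with
`(σ − 1)³ = 0` on the coordinates is conjugate to the identity / an LSB datum (first disjunct,
`D = ∅` allowed) or to a `J₃`-with-passengers datum (second disjunct) — the Jordan types of a
nilpotent `N = σ − 1` with `N³ = 0` in dimension `≤ 4` are `1111, 211, 22` (`N² = 0`:
`LinearSqZero.exists_conj_linearSmallBlocks_of_sq_zero`) and `31, 3` (`N² ≠ 0`:
`exists_basis_of_cube_zero`, realised by the coordinate change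
`LinearSqZero.exists_algEquiv_apply_X_eq` with `τ = φ⁻¹`). [OURS · L1 W4.5c; folklore] -/
theorem exists_conj_normalForm_of_cube_zero (k : Type) [Field k] (n : ℕ) (hn : n ≤ 4)
    (σ : MvPolynomial (Fin n) k ≃ₐ[k] MvPolynomial (Fin n) k)
    (hlin : ∀ i, σ (X i) ∈ Submodule.span k (Set.range (X : Fin n → MvPolynomial (Fin n) k)))
    (hcube : ∀ i, σ (σ (σ (X i) - X i) - (σ (X i) - X i)) = σ (σ (X i) - X i) - (σ (X i) - X i)) :
    ∃ τ : MvPolynomial (Fin n) k ≃ₐ[k] MvPolynomial (Fin n) k,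
      (∃ (D : Finset (Fin n)) (f : Fin n → Fin n), (∀ i ∈ D, f i ∉ D) ∧
        (∀ i ∈ D, (τ * σ * τ⁻¹) (X i) = X i + X (f i)) ∧ (∀ i ∉ D, (τ * σ * τ⁻¹) (X i) = X i)) ∨
      (∃ a b c : Fin n, a ≠ b ∧ b ≠ c ∧ a ≠ c ∧
        (τ * σ * τ⁻¹) (X b) = X b + X a ∧ (τ * σ * τ⁻¹) (X c) = X c + X b ∧
        ∀ i, i ≠ b → i ≠ c → (τ * σ * τ⁻¹) (X i) = X i) := by
  classical
  by_cases hsq : ∀ i, σ (σ (X i) - X i) = σ (X i) - X i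
  · -- `(σ − 1)² = 0`: square-zero normal form
    obtain ⟨τ, D, f, hfD, hD, hoff⟩ :=
      LinearSqZero.exists_conj_linearSmallBlocks_of_sq_zero k n σ hlin hsq
    exact ⟨τ, Or.inl ⟨D, f, hfD, hD, hoff⟩⟩
  · -- `(σ − 1)² ≠ 0`: one Jordan block `J₃` plus passengers
    push Not at hsq
    obtain ⟨i₀, hi₀⟩ := hsq
    let L := Submodule.span k (Set.range (X : Fin n → MvPolynomial (Fin n) k))
    have hX : LinearIndependent k (X : Fin n → MvPolynomial (Fin n) k) :=
      MvPolynomial.linearIndependent_X _ _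
    let bX : Basis (Fin n) k L := Basis.span hX
    haveI : FiniteDimensional k L := Module.Finite.of_basis bX
    have hrank : Module.finrank k L = n := by
      rw [Module.finrank_eq_card_basis bX, Fintype.card_fin]
    -- `σ` restricted to the degree-one part, and `N = σ − 1` there
    have hσL : ∀ x ∈ L, σ.toLinearMap x ∈ L := by
      intro x hx
      have h : Submodule.map σ.toLinearMap L ≤ L := by
        change Submodule.map σ.toLinearMap (Submodule.span k _) ≤ L
        rw [Submodule.map_span_le]
        rintro _ ⟨i, rfl⟩
        exact hlin i
      exact h ⟨x, hx, rfl⟩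
    let N : L →ₗ[k] L := σ.toLinearMap.restrict hσL - LinearMap.id
    have hNval : ∀ x : L, ((N x : L) : MvPolynomial (Fin n) k) = σ x - x := fun x => rfl
    have hbX : ∀ i, ((bX i : L) : MvPolynomial (Fin n) k) = X i :=
      fun i => congrArg Subtype.val (Basis.span_apply hX i)
    have hN3 : ∀ x : L, N (N (N x)) = 0 := by
      have h : N ∘ₗ N ∘ₗ N = 0 := by
        refine bX.ext fun i => Subtype.ext ?_
        rw [LinearMap.comp_apply, LinearMap.comp_apply, hNval, hNval, hNval, LinearMap.zero_apply,
          Submodule.coe_zero, hbX, hcube i, sub_self]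
      intro x
      have hx := congrArg (fun g : L →ₗ[k] L => g x) h
      simpa only [LinearMap.comp_apply, LinearMap.zero_apply] using hx
    have hv : N (N (bX i₀)) ≠ 0 := by
      intro h
      apply hi₀
      have h' := congrArg Subtype.val h
      rw [hNval, hNval, hbX, Submodule.coe_zero] at h'
      exact sub_eq_zero.1 h'
    -- Jordan basis and the coordinate change
    obtain ⟨B, a, b, c, hab, hbc, hac, hc, hb, hoff⟩ :=
      exists_basis_of_cube_zero N hN3 (bX i₀) hv hrank hn
    obtain ⟨φ, hφ⟩ := LinearSqZero.exists_algEquiv_apply_X_eq k n B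
    have hσB : ∀ i, σ (B i : MvPolynomial (Fin n) k) = B i + N (B i) := by
      intro i
      rw [hNval, add_sub_cancel]
    refine ⟨φ.symm, Or.inr ⟨a, b, c, hab, hbc, hac, ?_, ?_, fun i hib hic => ?_⟩⟩
    · rw [AlgEquiv.mul_apply, AlgEquiv.mul_apply, AlgEquiv.aut_inv, AlgEquiv.symm_symm, hφ, hσB,
        hb, ← hφ b, ← hφ a, ← map_add, AlgEquiv.symm_apply_apply]
    · rw [AlgEquiv.mul_apply, AlgEquiv.mul_apply, AlgEquiv.aut_inv, AlgEquiv.symm_symm, hφ, hσB,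
        hc, ← hφ c, ← hφ b, ← map_add, AlgEquiv.symm_apply_apply]
    · rw [AlgEquiv.mul_apply, AlgEquiv.mul_apply, AlgEquiv.aut_inv, AlgEquiv.symm_symm, hφ, hσB,
        hoff i hib hic, Submodule.coe_zero, add_zero, ← hφ i, AlgEquiv.symm_apply_apply]

end Summit.ResolutionOfSingularities.ResolutionOfSingularities.Theorems.WildQuotientResolution.LinearCubeZero

end
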